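import Summits.CriticalPhenomena.PercolationContinuityZ3.Theorems.Transplant.HexShadowSurgeryExchange
import HarnessLib

/-!
# HEXAGONAL SHADOWS XXVII — Fact 2 of DST §2.3 in hexagonal geometry, the geometry-free core III: the continuation stays in the old world; the recovery
# statistic `Att`; `ω^{(z)} ∈ C`

builds on p205010 (kernel theorem, internal audit signed; external expert review pending) — NOT used in this file.  Lane `prim-bschramm`, seat
`prim-bschramm-p2` (gen 32; class C1b; memo §117–§118); helper file (`--supports stmt-CriticalPhenomena-4575 --as helper`).  Slab original:
`Literature/…/SlabGluingFact2Core` §"Recovery"/"Attachment" — VERBATIM.  `tail_head`, `tail_props`, `tail_not_D` (the continuation of `γ_min(ω^{(z)})` after the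
rerouted piece leaves through the old exit edge, stays off the structure and off `D̄`, `ω`-joined to `\overline{src}` — propagation lemma «MinSAPRecovery»);
DST's recovery statistic **`HexShadow.att Γ ω'`** = the vertices of `γ_min(ω')` joined to `\overline{src'}` inside `\overline{big ∪ small}` off the rest of
`γ_min(ω')` ("`z` is the only vertex in `γ_min(ω^{(z)})` connected to `S'_n` off `γ_min(ω^{(z)})`", p. 7): **`c_mem_att`**, **`att_subset`** (`Att(ω^{(z)}) ⊆ D̄`),
**`newConfig_mem_evC`** (`ω^{(z)} ∈ C`), `att_nonempty`.
[cite: DuminilCopinSidoraviciusTassion2016, §2.3 (proof of Fact 2, p. 7)] [cite: NewmanTassionWu2017, §3.2 (proof of Thm. 3.9)]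
-/

noncomputable section

namespace Summit.CriticalPhenomena.PercolationContinuityZ3.Theorems.Transplant

open MeasureTheory Literature.Probability.Percolation Literature.Probability.LatticeModels SimpleGraph Filter
open scoped Classical Topology

namespace HexShadow.Surgery

variable {V : Type} {G : SimpleGraph V} {Φ : HexShadow G} [Countable V] {Γ : GlueData} {ω : BondConfig V} (sg : Φ.Surgery Γ ω)

/-- `γ_min(ω^{(z)})` is an open self-avoiding path of `ω^{(z)}`. [folklore] -/
theorem μ_openSAP (hX : ω ∈ Φ.evX Γ) :
    OpenSAP sg.newConfig (Φ.lift (Φ.big Γ)) (Φ.lift (Φ.src Γ)) (Φ.lift (Φ.zSeg Γ))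
      (Φ.γmin Γ sg.newConfig) :=
  (minSAP_spec (Φ.lift_big_finite Γ) ⟨_, sg.openSAP_T (HexShadow.evA_of_evX hX)⟩).1

/-- `S̄_{3n} ∋ p₀.head` is `ω`-joined inside `B̄_{3n} ∪ B̄'_n` to every vertex of `γ`. [folklore] -/
theorem joined_of_mem_γ (hA : ω ∈ Φ.evA Γ) {v : V} (hv : v ∈ Φ.γmin Γ ω) :
    ω ∈ openConnIn (Φ.lift (Φ.big Γ ∪ Φ.small Γ)) (sg.p₀.head sg.hp₀) v := by
  have hγO := (Φ.γmin_spec Γ hA).1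
  have h := hγO.openConnIn_of_mem hv
  have hh : (Φ.γmin Γ ω).head hγO.ne_nil = sg.p₀.head sg.hp₀ := by
    rw [List.head_eq_iff_head?_eq_some, sg.γ_head?]
  rw [hh] at h
  exact openConnIn_mono (Φ.lift_mono Set.subset_union_left) _ _ h

/-- **The continuation starts with the old exit edge**: if `γ_min(ω^{(z)}) = p₀ ++ E₁ :: P ++
E₂ :: tail` with `tail ≠ []`, then `tail.head = s₀.head` (the only open edges at `E₂` are the
structure edge and the stub). [cite: DuminilCopinSidoraviciusTassion2016, §2.3, proof of Fact 2] -/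
theorem tail_head (hX : ω ∈ Φ.evX Γ) {tail : List V}
    (hμ : Φ.γmin Γ sg.newConfig = sg.p₀ ++ (sg.SP ++ tail)) (ht : tail ≠ []) :
    tail.head ht = sg.s₀.head sg.hs₀ := by
  have hμO := sg.μ_openSAP hX
  have hch := hμO.chain
  have hnd := hμO.nodup
  rw [hμ] at hch hnd
  set t₁ := tail.head ht with ht₁
  have hrel : s(sg.E₂, t₁) ∈ sg.newConfig ∧ sg.E₂ ≠ t₁ := by
    have h1 := (List.isChain_append.1 hch).2.1
    have h2 := List.IsChain.rel_getLast_head_of_append h1 (by simp [SP]) ht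
    have h3 : sg.SP.getLast (by simp [SP]) = sg.E₂ := by simp [SP]
    rwa [h3] at h2
  have ht₁SP : t₁ ∉ sg.SP := by
    intro h
    have := (List.nodup_append.1 (List.nodup_append.1 hnd).2.1).2.2 t₁ h t₁ (List.head_mem ht) rfl
    exact this
  have hrel' : s(t₁, sg.E₂) ∈ sg.newConfig := by rw [Sym2.eq_swap]; exact hrel.1
  rcases sg.edge_at_D hrel' sg.hE₂D with (he | he) | he
  · -- a structure edge of `SP` at its last vertex leads to the predecessor, inside `SP`
    exfalso
    have he' : s(sg.E₂, t₁) ∈ edgesOf ((sg.E₁ :: sg.P) ++ [sg.E₂]) := by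
      rw [Sym2.eq_swap]; simpa [SP] using he
    have hnd' : ((sg.E₁ :: sg.P) ++ [sg.E₂]).Nodup := by simpa [SP] using sg.hSPnodup
    obtain ⟨l₁', hl₁'⟩ := eq_of_mem_edgesOf_last hnd' he'
    apply ht₁SP
    have : t₁ ∈ sg.E₁ :: sg.P := by rw [hl₁']; simp
    simp only [SP, List.mem_cons, List.mem_append]
    rcases List.mem_cons.1 this with h | h
    · exact Or.inl h
    · exact Or.inr (Or.inl h)
  · -- a branch edge at `E₂`: impossible, `E₂ ∉ c :: Br`
    exfalso
    obtain ⟨-, hE₂⟩ := mem_of_mem_edgesOf he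
    rcases List.mem_cons.1 hE₂ with h | h
    · exact sg.ne_facts.1 h.symm
    · exact sg.hBrSP _ h sg.SP_mems.2.1
  · rcases sg.stubs_cases_D he sg.hE₂D with ⟨h, -⟩ | ⟨-, h⟩ | ⟨h, -⟩
    · exact absurd h.symm sg.ne_facts.2
    · exact h
    · exact absurd sg.SP_mems.2.1 (h ▸ sg.w'_facts.2.2.2)

/-- **The continuation lives in the old world**: every vertex of `tail` is off the structure and
`ω`-joined to `S̄_{3n}` inside `B̄_{3n} ∪ B̄'_n` (propagation from `s₀.head`).
[cite: DuminilCopinSidoraviciusTassion2016, §2.3, proof of Fact 2] -/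
theorem tail_props (hX : ω ∈ Φ.evX Γ) {tail : List V}
    (hμ : Φ.γmin Γ sg.newConfig = sg.p₀ ++ (sg.SP ++ tail)) {q : V} (hq : q ∈ tail) :
    q ∉ sg.Sw ∧ ω ∈ openConnIn (Φ.lift (Φ.big Γ ∪ Φ.small Γ)) (sg.p₀.head sg.hp₀) q := by
  have hA := HexShadow.evA_of_evX hX
  have ht : tail ≠ [] := List.ne_nil_of_mem hq
  have hμO := sg.μ_openSAP hX
  have hch := hμO.chain
  have hnd := hμO.nodup
  rw [hμ] at hch hnd
  obtain ⟨t₁, tail', htail⟩ := List.exists_cons_of_ne_nil ht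
  have ht₁ : t₁ = sg.s₀.head sg.hs₀ := by
    have := sg.tail_head hX hμ ht
    rw [List.head_eq_iff_head?_eq_some, htail] at this
    simpa using this
  -- the open path along `tail` from `t₁` to `q`, inside `A = B̄_{3n} ∖ SP`
  set A : Set V := Φ.lift (Φ.big Γ) ∩ {v | v ∉ sg.SP} with hAdef
  have htailch : tail.IsChain (fun a b => s(a, b) ∈ sg.newConfig ∧ a ≠ b) :=
    (List.isChain_append.1 (List.isChain_append.1 hch).2.1).2.1
  have htailA : ∀ x ∈ tail, x ∈ A := by
    intro x hx
    refine ⟨hμO.subset x (by rw [hμ]; simp [hx]), fun hxSP => ?_⟩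
    exact (List.nodup_append.1 (List.nodup_append.1 hnd).2.1).2.2 x hxSP x hx rfl
  have hpath : sg.newConfig ∈ openConnIn A t₁ q := by
    rw [htail] at htailch htailA hq
    exact openConnIn_head_of_mem_chain t₁ tail' htailch htailA q hq
  refine not_mem_structure_of_openConnIn' (Reg := Φ.lift (Φ.big Γ ∪ Φ.small Γ))
    (fun x hx => Φ.lift_mono Set.subset_union_left hx.1) sg.structEdges sg.Wv sg.Sw
    {sg.E₁, sg.E₂} sg.Wv_subset_Sw (sg.p₀.head sg.hp₀) (sg.newConfig_subset hA)
    (fun a b h => sg.structEdges_Sw h) (fun t x h hx => sg.edge_into_Wv h hx) ?_ ?_ hpath ?_ ?_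
  · rintro x ⟨-, hx⟩ hK
    exfalso
    rcases hK with rfl | rfl
    · exact hx sg.SP_mems.1
    · exact hx sg.SP_mems.2.1
  · intro x hx hxW hj
    have hxw : x = sg.w' := by
      by_contra hne
      exact hxW ⟨hx, hne⟩
    subst hxw
    exact sg.w'_not_joined hX (sg.p₀_head_mem_src hA) hj
  · rw [ht₁]; exact sg.s₀_not_Sw (List.head_mem _)
  · rw [ht₁]; exact sg.joined_of_mem_γ hA (sg.mem_γ_of_mem_s₀ (List.head_mem _))

/-- **The continuation avoids `D̄`.** [cite: DuminilCopinSidoraviciusTassion2016, §2.3, proof of Fact 2] -/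
theorem tail_not_D (hX : ω ∈ Φ.evX Γ) {tail : List V}
    (hμ : Φ.γmin Γ sg.newConfig = sg.p₀ ++ (sg.SP ++ tail)) {q : V} (hq : q ∈ tail) :
    Φ.sh q ∉ sg.D := by
  intro hqD
  have ht : tail ≠ [] := List.ne_nil_of_mem hq
  obtain ⟨t₁, tail', htail⟩ := List.exists_cons_of_ne_nil ht
  have ht₁ : t₁ = sg.s₀.head sg.hs₀ := by
    have := sg.tail_head hX hμ ht
    rw [List.head_eq_iff_head?_eq_some, htail] at this
    simpa using this
  rw [htail] at hq
  rcases List.mem_cons.1 hq with rfl | hq'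
  · exact sg.s₀_head_not_D (ht₁ ▸ hqD)
  · -- the edge of `γ_min(ω^{(z)})` into `q` would make `q` a structure vertex
    obtain ⟨u, v, huv⟩ := List.append_of_mem hq'
    have hch := (sg.μ_openSAP hX).chain
    rw [hμ, htail, huv] at hch
    have h1 : ((sg.p₀ ++ (sg.SP ++ t₁ :: u)) ++ q :: v).IsChain
        (fun a b => s(a, b) ∈ sg.newConfig ∧ a ≠ b) := by
      simpa [List.append_assoc] using hch
    have h2 := List.IsChain.rel_getLast_head_of_append h1 (by simp) (by simp)
    simp only [List.head_cons] at h2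
    have hqSw := sg.mem_Sw_of_edge h2.1 hqD
    have hq'' : q ∈ tail := by rw [htail, huv]; simp
    exact (sg.tail_props hX hμ hq'').1 hqSw

end HexShadow.Surgery

/-- **DST's recovery statistic**: the vertices `q` of `γ_min(ω')` joined to `S̄'_n` inside
`B̄_{3n} ∪ B̄'_n` by an `ω'`-open path avoiding the other vertices of `γ_min(ω')` ("`z` is the
only vertex in `γ_min(ω^{(z)})` which is connected to `S'_n` in `B'_n ∖ γ_min(ω^{(z)})`",
p. 7; here with the region `B̄_{3n} ∪ B̄'_n`). A function of `ω'` alone.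
[cite: DuminilCopinSidoraviciusTassion2016, §2.3, proof of Fact 2 (p. 7)] -/
def HexShadow.att {V : Type} {G : SimpleGraph V} (Φ : HexShadow G) [Countable V] (Γ : GlueData) (ω' : BondConfig V) : Set V :=
  {q | q ∈ Φ.γmin Γ ω' ∧ ∃ s' ∈ Φ.lift (Φ.src' Γ),
    ω' ∈ openConnIn (Φ.lift (Φ.big Γ ∪ Φ.small Γ) ∩ {v | v ∉ Φ.γmin Γ ω' ∨ v = q}) q s'}

namespace HexShadow.Surgery

variable {V : Type} {G : SimpleGraph V} {Φ : HexShadow G} [Countable V] {Γ : GlueData} {ω : BondConfig V} (sg : Φ.Surgery Γ ω)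

/-- The structure path lies in `B̄_{3n} ∪ B̄'_n`. [folklore] -/
theorem SP_subset_Reg {x : V} (hx : x ∈ sg.SP) : x ∈ Φ.lift (Φ.big Γ ∪ Φ.small Γ) :=
  sg.hD (sg.SP_D hx)

/-- The branch lies in `B̄_{3n} ∪ B̄'_n`. [folklore] -/
theorem Br_subset_Reg {x : V} (hx : x ∈ sg.Br) : x ∈ Φ.lift (Φ.big Γ ∪ Φ.small Γ) :=
  sg.hD (sg.hBrD x hx)

/-- Every vertex of `σ` is `ω`-joined inside `B̄'_n` to the end of `σ` (in `S̄'_n`). [folklore] -/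
theorem σ_joined {x : V} (hx : x ∈ sg.σ) :
    ω ∈ openConnIn (Φ.lift (Φ.small Γ)) x (sg.σ.getLast sg.σ_ne_nil) := by
  have hch := sg.hσchain
  have hσ := sg.σ_eq_cons
  rw [hσ] at hch
  have hsub : ∀ y ∈ sg.w' :: sg.σ.tail, y ∈ Φ.lift (Φ.small Γ) :=
    fun y hy => sg.hσsmall y (by rw [hσ]; exact hy)
  have h1 : ω ∈ openConnIn (Φ.lift (Φ.small Γ)) sg.w' x :=
    openConnIn_head_of_mem_chain _ _ hch hsub x (by rw [hσ] at hx; exact hx)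
  have h2 : ω ∈ openConnIn (Φ.lift (Φ.small Γ)) sg.w' ((sg.w' :: sg.σ.tail).getLast (by simp)) :=
    openConnIn_of_isChain' _ _ hch hsub
  have h3 : (sg.w' :: sg.σ.tail).getLast (by simp) = sg.σ.getLast sg.σ_ne_nil :=
    List.getLast_congr _ _ hσ.symm
  rw [h3] at h2
  exact SlabCriticality.openConnIn_trans (openConnIn_reverse h1) h2

/-- A vertex of `σ` is not `ω`-joined to `S̄_{3n}` inside `B̄_{3n} ∪ B̄'_n`. [folklore] -/
theorem σ_not_joined (hX : ω ∈ Φ.evX Γ) {x : V} (hx : x ∈ sg.σ) {a : V}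
    (ha : a ∈ Φ.lift (Φ.src Γ)) (h : ω ∈ openConnIn (Φ.lift (Φ.big Γ ∪ Φ.small Γ)) a x) : False := by
  obtain ⟨-, hC⟩ := hX
  exact hC ⟨a, ha, _, sg.hσsrc' sg.σ_ne_nil, SlabCriticality.openConnIn_trans h
    (openConnIn_mono (Φ.lift_mono Set.subset_union_right) _ _ (sg.σ_joined hx))⟩

/-- **The attachment vertex is recovered**: `c ∈ Att(ω^{(z)})`, via the branch and `σ`.
[cite: DuminilCopinSidoraviciusTassion2016, §2.3, proof of Fact 2 (p. 7)] -/
theorem c_mem_att (hX : ω ∈ Φ.evX Γ) : sg.c ∈ Φ.att Γ sg.newConfig := by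
  have hA := HexShadow.evA_of_evX hX
  obtain ⟨tail, hμ⟩ := sg.exists_tail hX
  refine ⟨by rw [hμ]; simp [sg.SP_mems.2.2], sg.σ.getLast sg.σ_ne_nil, sg.hσsrc' _, ?_⟩
  -- the walk `c :: Br ++ σ.tail`
  set A : Set V :=
    Φ.lift (Φ.big Γ ∪ Φ.small Γ) ∩ {v | v ∉ Φ.γmin Γ sg.newConfig ∨ v = sg.c} with hAdef
  have hσch : (sg.w' :: sg.σ.tail).IsChain (fun a b => s(a, b) ∈ ω ∧ a ≠ b) := by
    have := sg.hσchain; rwa [sg.σ_eq_cons] at this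
  have hch : (sg.c :: (sg.Br ++ sg.σ.tail)).IsChain (fun a b => s(a, b) ∈ sg.newConfig ∧ a ≠ b) := by
    rw [← List.cons_append]
    refine List.IsChain.append ?_ ?_ ?_
    · exact isChain_of_edgesOf_subset sg.hBrchain
        fun e he => sg.structEdges_sub_newConfig (Or.inr he)
    · rw [List.isChain_cons] at hσch
      exact hσch.2.imp_of_mem_imp fun a b ha hb h =>
        ⟨sg.mem_newConfig_of_off h.1 (sg.hσD a ha) (sg.hσD b hb), h.2⟩
    · intro x hx y hy
      have hx' : x = sg.w' := by
        rw [List.getLast?_eq_some_getLast (by simp), Option.mem_def, Option.some.injEq] at hx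
        rw [← hx, List.getLast_cons sg.hBr]; rfl
      subst hx'
      refine ⟨sg.stub₃_mem hy, ?_⟩
      rw [List.isChain_cons] at hσch
      exact (hσch.1 y hy).2
  have hsub : ∀ x ∈ sg.c :: (sg.Br ++ sg.σ.tail), x ∈ A := by
    intro x hx
    rcases List.mem_cons.1 hx with rfl | hx
    · exact ⟨sg.SP_subset_Reg sg.SP_mems.2.2, Or.inr rfl⟩
    rcases List.mem_append.1 hx with hx | hx
    · refine ⟨sg.Br_subset_Reg hx, Or.inl fun hμx => ?_⟩
      rw [hμ] at hμx
      rcases List.mem_append.1 hμx with h | h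
      · exact sg.hp₀D x h (sg.hBrD x hx)
      rcases List.mem_append.1 h with h | h
      · exact sg.hBrSP x hx h
      · exact sg.tail_not_D hX hμ h (sg.hBrD x hx)
    · have hxσ : x ∈ sg.σ := List.mem_of_mem_tail hx
      refine ⟨Φ.lift_mono Set.subset_union_right (sg.hσsmall x hxσ), Or.inl fun hμx => ?_⟩
      rw [hμ] at hμx
      rcases List.mem_append.1 hμx with h | h
      · exact sg.hσγ x hxσ ⟨x, sg.mem_γ_of_mem_p₀ h, rfl⟩
      rcases List.mem_append.1 h with h | h
      · exact sg.hσD x hx (sg.SP_D h)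
      · exact sg.σ_not_joined hX hxσ (sg.p₀_head_mem_src hA) (sg.tail_props hX hμ h).2
  have hconn := openConnIn_of_isChain' _ _ hch hsub
  have hlast : (sg.c :: (sg.Br ++ sg.σ.tail)).getLast (List.cons_ne_nil _ _) =
      sg.σ.getLast sg.σ_ne_nil := by
    have e1 : sg.Br ++ sg.σ.tail = sg.Br.dropLast ++ (sg.w' :: sg.σ.tail) := by
      conv_lhs => rw [← List.dropLast_concat_getLast sg.hBr]
      rw [List.append_assoc]; rfl
    have hne1 : sg.Br ++ sg.σ.tail ≠ [] := by simp [sg.hBr]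
    have hne2 : sg.Br.dropLast ++ sg.w' :: sg.σ.tail ≠ [] := by simp
    rw [List.getLast_cons hne1, List.getLast_congr hne1 hne2 e1,
      List.getLast_append_of_ne_nil _ (List.cons_ne_nil _ _), List.getLast_congr _ _ sg.σ_eq_cons]
  rw [hlast] at hconn
  exact hconn

/-- **The statistic localises the surgery**: `Att(ω^{(z)}) ⊆ D̄` — a vertex of
`γ_min(ω^{(z)})` off `D̄` is an old-world vertex `ω`-joined to `S̄_{3n}`, and an `ω^{(z)}`-open
path from it to `S̄'_n` avoiding the rest of `γ_min(ω^{(z)})` cannot enter the structure, so it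
would be `ω`-open and give `C(ω)`. [cite: DuminilCopinSidoraviciusTassion2016, §2.3, proof of Fact 2 (p. 7)] -/
theorem att_subset (hX : ω ∈ Φ.evX Γ) : Φ.att Γ sg.newConfig ⊆ Φ.lift sg.D := by
  have hA := HexShadow.evA_of_evX hX
  obtain ⟨tail, hμ⟩ := sg.exists_tail hX
  rintro q ⟨hqμ, s', hs', hj⟩
  by_contra hqD
  rw [HexShadow.mem_lift] at hqD
  have hqSw : q ∉ sg.Sw := fun h => hqD (sg.Sw_D h)
  have hq0 : ω ∈ openConnIn (Φ.lift (Φ.big Γ ∪ Φ.small Γ)) (sg.p₀.head sg.hp₀) q := by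
    rw [hμ] at hqμ
    rcases List.mem_append.1 hqμ with h | h
    · exact sg.joined_of_mem_γ hA (sg.mem_γ_of_mem_p₀ h)
    rcases List.mem_append.1 h with h | h
    · exact absurd (sg.SP_D h) hqD
    · exact (sg.tail_props hX hμ h).2
  have hres := not_mem_structure_of_openConnIn' (Reg := Φ.lift (Φ.big Γ ∪ Φ.small Γ))
    (A := Φ.lift (Φ.big Γ ∪ Φ.small Γ) ∩ {v | v ∉ Φ.γmin Γ sg.newConfig ∨ v = q})
    (fun x hx => hx.1) sg.structEdges sg.Wv sg.Sw {sg.E₁, sg.E₂} sg.Wv_subset_Sw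
    (sg.p₀.head sg.hp₀) (sg.newConfig_subset hA) (fun a b h => sg.structEdges_Sw h)
    (fun t x h hx => sg.edge_into_Wv h hx) ?_ ?_ hj hqSw hq0
  · obtain ⟨-, hC⟩ := hX
    exact hC ⟨_, sg.p₀_head_mem_src hA, s', hs', hres.2⟩
  · rintro x ⟨-, hx⟩ hK
    exfalso
    have hxSP : x ∈ sg.SP := by
      rcases hK with rfl | rfl
      · exact sg.SP_mems.1
      · exact sg.SP_mems.2.1
    rcases hx with hx | rfl
    · exact hx (by rw [hμ]; simp [hxSP])
    · exact hqD (sg.SP_D hxSP)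
  · intro x hx hxW hj'
    have hxw : x = sg.w' := by
      by_contra hne
      exact hxW ⟨hx, hne⟩
    subst hxw
    exact sg.w'_not_joined ⟨⟨⟨hA, hX.1.1.2⟩, hX.1.2⟩, hX.2⟩ (sg.p₀_head_mem_src hA) hj'

/-- **The new configuration realises `C`**: `S_{3n} ⟷ S'_n` in `B̄_{3n} ∪ B̄'_n` (along `γ` to
`E₁`, the rerouted piece to `c`, the branch, and `σ`). [cite: DuminilCopinSidoraviciusTassion2016, §2.3, proof of Fact 2 ("By construction, ω^{(z)} is in {S_{3n} ⟷ S'_n}")] -/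
theorem newConfig_mem_evC (hX : ω ∈ Φ.evX Γ) : sg.newConfig ∈ Φ.evC Γ := by
  have hA := HexShadow.evA_of_evX hX
  obtain ⟨hcμ, s', hs', hj⟩ := sg.c_mem_att hX
  have hμO := sg.μ_openSAP hX
  have h1 := hμO.openConnIn_of_mem hcμ
  obtain ⟨tail, hμ⟩ := sg.exists_tail hX
  have hh : (Φ.γmin Γ sg.newConfig).head hμO.ne_nil = sg.p₀.head sg.hp₀ := by
    rw [List.head_eq_iff_head?_eq_some, hμ, List.head?_append, List.head?_eq_some_head sg.hp₀]
    rfl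
  rw [hh] at h1
  exact ⟨_, sg.p₀_head_mem_src hA, s', hs', SlabCriticality.openConnIn_trans
    (openConnIn_mono (Φ.lift_mono Set.subset_union_left) _ _ h1)
    (openConnIn_mono (fun x hx => hx.1) _ _ hj)⟩

/-- The attachment statistic of `ω^{(z)}` is non-empty. [folklore] -/
theorem att_nonempty (hX : ω ∈ Φ.evX Γ) : (Φ.att Γ sg.newConfig).Nonempty := ⟨sg.c, sg.c_mem_att hX⟩

end HexShadow.Surgery

end Summit.CriticalPhenomena.PercolationContinuityZ3.Theorems.Transplant

end
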